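import Summits.QuantumFields.QCD.Theorems.NestedDissectionSeaCoerciveOfDiluteLeaf

/-!
# Route `NestedDissectionSea`, support `CoerciveOfDilute` (stmt-QuantumFields-14759) —
# the large-leaf residual: the separator Wegner law is needed only on boxes with all sides `≥ 2^r b₀`

Companion of `NestedDissectionSeaCoerciveOfDiluteLeaf` (leaf doubling / scaling of clause (ii) under the
kinetic margin `∀ᶠ k, −4(1 − cos(π/(2^{r+2} b₀))) < mcrit k`). Here the leaf-scale freedom is fed into the
`∃`-alignment of the glue item `CoerciveOfDilute : NegativeCellsDilute → CoerciveSea`: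

* `coerciveSeaAt_of_body_of_law` — the `∃`-alignment at a FIXED regularisation
  (`coerciveOfDilute_of_separatorWegnerLaw` refactored through `CoerciveSeaAt`): the body of
  `NegativeCellsDilute` at `(reg, M₀, b₀, ℓ)` plus the separator Wegner law along `reg` at leaf `b₀` (free
  `M₁, ℓ₁, R, C, α, t₀`) is a witness of the hinge.
* `coerciveOfDilute_of_rewitnessedLaw` — the general shape of the glue: from each certified
  `(reg, M₀, b₀, ℓ)` it suffices to exhibit ANY admissible `(reg′, M₀′, b₀′, ℓ′)` carrying the body of
  `NegativeCellsDilute` together with the law along `reg′` at leaf `b₀′` (instances: `reg′ = reg`,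
  `reg′ = reg ∘ φ` of the earlier files; `b₀′ = 2^r b₀` below).
* `ncdBody_leafScaling` — the body of `NegativeCellsDilute` passes from leaf `b₀` to leaf `2^r b₀` under the
  kinetic margin (`dilution_leafScaling` per mass tuple, the pin by `pin_mono`).
* `coerciveOfDilute_of_largeLeafWegnerLaw` — THE USE: it suffices to prove the separator Wegner law along
  the certified regularisation for the roughly cubic window boxes WITH ALL SIDES `≥ 2^r b₀`, `r` at the
  supplier's choice, provided (for `r ≥ 1`) `∀ᶠ k, −4(1 − cos(π/(2^{r+2} b₀))) < mcrit k`. On the physical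
  branch (`mcrit k → 0⁻`) every `r` qualifies, so the `∀ reg` laws of crux 13901's picked line need never be
  proved on boxes of bounded lattice size — in particular not on the one-site box `(2,2,2,2)` of the `b₀ = 2`
  exposure (`separatorLaw_false_of_pin_of_cluster_neg_four`), nor on two-site / single-plaquette boxes.

This does not prove the item: the law on large boxes is clause (i) of crux `CoerciveSea` (stmt-13901).
Standard material. [folklore]
-/

noncomputable section

open scoped BigOperators Classical
open MeasureTheory Filter Matrix
open Literature.MathematicalPhysics.QuantumLattice Literature.MathematicalPhysics.QuantumFieldTheory
  Literature.Probability.LatticeModels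
open Summit.QuantumFields.QCD.Theses.NestedDissectionSea
open Summit.QuantumFields.QCD.Theorems.CoerciveSeaNegative

namespace Summit.QuantumFields.QCD.Theorems.NestedDissectionSeaCoerciveOfDilute

/-! ## 1. The per-regularisation `∃`-alignment and the general shape of the glue -/

/-- **The `∃`-alignment at a fixed regularisation** (`coerciveOfDilute_of_separatorWegnerLaw`, per
`reg`, concluded as `CoerciveSeaAt`): an admissible `reg` with data `M₀ ≥ 0`, `b₀ ≥ 2`, `ℓ > 0`
carrying the BODY of `NegativeCellsDilute`, together with the separator Wegner law along `reg` at leaf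
`b₀` with free threshold `M₁`, window `ℓ₁ > 0`, per-tuple `R, C, α > 0` and level cap `t₀ > 0`, is a
witness of `CoerciveSea` (`CoerciveSeaAt Nf reg`): threshold `max M₀ M₁`, window `min ℓ ℓ₁`, size
`max (max R₀ R) ℓ`; (ii) by `dilution_mono`, (iii) by `pin_mono`, (i) extended to `t ∈ (t₀, 1]` by
`P_pq ≤ 1`. [folklore] -/
theorem coerciveSeaAt_of_body_of_law {Nf : ℕ} {reg : QCDRegularisation Nf} (hms : reg.HasMassScaling)
    (has : (reg.scheme 0 0 0).HasAsymptoticScaling) {M₀ : ℝ} (hM₀ : 0 ≤ M₀) {b₀ : ℕ} (hb₀ : 2 ≤ b₀)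
    {ℓ : ℝ} (hℓ : 0 < ℓ)
    (hbody : ∀ m : Fin Nf → ℝ, (∀ f, M₀ < m f) → ∃ R : ℝ, 0 < R ∧ (∀ ε : ℝ, 0 < ε → ∀ᶠ k : ℕ in Filter.atTop, ∀ S : ℕ, R ≤ reg.a k * (2 * S + 1) → let N : ℕ := 2 * S + 1; let mq : Fin Nf → ℝ := fun f => reg.mcrit k + reg.a k * m f / reg.Zm k; let wt : GaugeConfig 4 N (Matrix.specialUnitaryGroup (Fin 3) ℂ) → ℝ := fun U => ∏ f, ‖fermionDet (wilsonDirac (fundamentalRep (Fin 3)) U (mq f) 1)‖; let P : (GaugeConfig 4 N (Matrix.specialUnitaryGroup (Fin 3) ℂ) → Prop) → ℝ := fun E => (∫ U, (if E U then (1 : ℝ) else 0) * wt U ∂(wilsonMeasure (d := 4) (L := N) (fundamentalRep (Fin 3)) (reg.β k))) / (∫ U, wt U ∂(wilsonMeasure (d := 4) (L := N) (fundamentalRep (Fin 3)) (reg.β k))); let J : ℕ := Nat.log 2 (⌊ℓ / reg.a k⌋₊ / b₀) + 1; ∃ δ : ℕ → ℝ, ∑ j ∈ Finset.range J, δ j ≤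 ε ∧ ∀ j < J, ∀ s : Fin 4 → ℕ, (∀ i, b₀ * 2 ^ j ≤ s i ∧ s i < b₀ * 2 ^ (j + 2) ∧ s i ≤ N ∧ (s i : ℝ) * reg.a k ≤ ℓ) → P (fun U => ∃ f, IsSignDefect U (mq f) j s) ≤ δ j) ∧ PinClause Nf reg M₀ m R)
    (hlaw : ∃ M₁ ℓ₁ : ℝ, 0 < ℓ₁ ∧ ∀ m : Fin Nf → ℝ, (∀ f, M₁ < m f) →
        ∃ R C α t₀ : ℝ, 0 < α ∧ 0 < t₀ ∧ ∀ᶠ k : ℕ in Filter.atTop, ∀ S : ℕ, R ≤ reg.a k * (2 * S + 1) →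
          let N : ℕ := 2 * S + 1
          let mq : Fin Nf → ℝ := fun f => reg.mcrit k + reg.a k * m f / reg.Zm k
          let wt : GaugeConfig 4 N (Matrix.specialUnitaryGroup (Fin 3) ℂ) → ℝ := fun U =>
            ∏ f, ‖fermionDet (wilsonDirac (fundamentalRep (Fin 3)) U (mq f) 1)‖
          let P : (GaugeConfig 4 N (Matrix.specialUnitaryGroup (Fin 3) ℂ) → Prop) → ℝ := fun E =>
            (∫ U, (if E U then (1 : ℝ) else 0) * wt U
                ∂(wilsonMeasure (d := 4) (L := N) (fundamentalRep (Fin 3)) (reg.β k))) /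
              (∫ U, wt U ∂(wilsonMeasure (d := 4) (L := N) (fundamentalRep (Fin 3)) (reg.β k)))
          ∀ s : Fin 4 → ℕ, (∀ i, b₀ ≤ s i ∧ s i ≤ N ∧ (s i : ℝ) * reg.a k ≤ ℓ₁) →
            (∀ i j, s i ≤ 2 * s j) → ∀ f : Fin Nf, ∀ t : ℝ, 0 < t → t ≤ t₀ →
              P (fun U => HasSingularSeparator U (mq f) s (t / s 0)) ≤ C * t ^ α) :
    CoerciveSeaAt Nf reg := by
  obtain ⟨M₁, ℓ₁, hℓ₁, hlaw⟩ := hlaw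
  refine ⟨hms, has, max M₀ M₁, hM₀.trans (le_max_left _ _), b₀, hb₀, min ℓ ℓ₁, lt_min hℓ hℓ₁,
    fun m hmm => ?_⟩
  have hm₀ : ∀ f, M₀ < m f := fun f => (le_max_left _ _).trans_lt (hmm f)
  have hm₁ : ∀ f, M₁ < m f := fun f => (le_max_right _ _).trans_lt (hmm f)
  obtain ⟨R₀, hR₀, hDil, hPin⟩ := hbody m hm₀
  obtain ⟨Rw, C, α, t₀, hα, ht₀, hlawk⟩ := hlaw m hm₁
  have hR' : R₀ ≤ max (max R₀ Rw) ℓ := (le_max_left _ _).trans (le_max_left _ _)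
  refine ⟨max (max R₀ Rw) ℓ, hR₀.trans_le hR', ?_, ?_, ?_⟩
  · -- clause (i): the law on the boxes of the smaller window, extended to all `t ∈ (0, 1]`
    have ht₀α : 0 < t₀ ^ α := Real.rpow_pos_of_pos ht₀ α
    refine ⟨max C 0 + (t₀ ^ α)⁻¹, add_pos_of_nonneg_of_pos (le_max_right _ _) (inv_pos.mpr ht₀α),
      α, hα, ?_⟩
    filter_upwards [hlawk] with k hk
    intro S hS
    have hk' := hk S (((le_max_right _ _).trans (le_max_left _ _)).trans hS)
    dsimp only at hk' ⊢
    intro s hs hcub f t ht0 ht1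
    have hs' : ∀ i, b₀ ≤ s i ∧ s i ≤ 2 * S + 1 ∧ (s i : ℝ) * reg.a k ≤ ℓ₁ := fun i =>
      ⟨(hs i).1, (hs i).2.1, (hs i).2.2.trans (min_le_right _ _)⟩
    have htα : 0 ≤ t ^ α := (Real.rpow_pos_of_pos ht0 α).le
    have hC0 : 0 ≤ max C 0 := le_max_right _ _
    have hinv : 0 ≤ (t₀ ^ α)⁻¹ := (inv_pos.mpr ht₀α).le
    by_cases htt : t ≤ t₀
    · calc _ ≤ C * t ^ α := hk' s hs' hcub f t ht0 htt
        _ ≤ max C 0 * t ^ α := mul_le_mul_of_nonneg_right (le_max_left _ _) htα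
        _ ≤ (max C 0 + (t₀ ^ α)⁻¹) * t ^ α := by nlinarith [mul_nonneg hinv htα]
    · have hpow : t₀ ^ α ≤ t ^ α := Real.rpow_le_rpow ht₀.le (not_le.mp htt).le hα.le
      calc _ ≤ (1 : ℝ) :=
            quenchedRatio_le_one _ (fun U => Finset.prod_nonneg fun f _ => norm_nonneg _) _
        _ = (t₀ ^ α)⁻¹ * t₀ ^ α := (inv_mul_cancel₀ ht₀α.ne').symm
        _ ≤ (t₀ ^ α)⁻¹ * t ^ α := mul_le_mul_of_nonneg_left hpow hinv
        _ ≤ (max C 0 + (t₀ ^ α)⁻¹) * t ^ α := by nlinarith [mul_nonneg hC0 htα]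
  · -- clause (ii): the body's dilution, moved down to the smaller window
    exact dilution_mono reg hb₀ (lt_min hℓ hℓ₁) (min_le_left _ _) hR' (le_max_right _ _) m hDil
  · -- clause (iii): the body's pin, restricted to larger `M₀` and `R`
    exact pin_mono hPin (le_max_left _ _) hR'

/-- **The general shape of the glue (re-witnessing).** `CoerciveOfDilute` holds as soon as, from
every certified `(reg, M₀, b₀, ℓ)` (an admissible `reg` and data carrying the body of
`NegativeCellsDilute`), one can exhibit SOME admissible `reg'` and data `(M₀', b₀', ℓ')` again carrying
the body of `NegativeCellsDilute`, together with the separator Wegner law along `reg'` at leaf `b₀'`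
(free `M₁, ℓ₁, R, C, α, t₀`). The earlier reductions are the instances `reg' = reg`
(`coerciveOfDilute_of_separatorWegnerLaw`), `reg' = reg ∘ φ` (`coerciveOfDilute_of_subseqWegnerLaw`);
`coerciveOfDilute_of_largeLeafWegnerLaw` below is the instance `b₀' = 2^r b₀`. [folklore] -/
theorem coerciveOfDilute_of_rewitnessedLaw
    (hW : ∀ (Nf : ℕ) (reg : QCDRegularisation Nf), (Nf = 2 ∨ Nf = 3) → reg.HasMassScaling →
      (reg.scheme 0 0 0).HasAsymptoticScaling → ∀ M₀ : ℝ, 0 ≤ M₀ → ∀ b₀ : ℕ, 2 ≤ b₀ → ∀ ℓ : ℝ, 0 < ℓ →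
      (∀ m : Fin Nf → ℝ, (∀ f, M₀ < m f) → ∃ R : ℝ, 0 < R ∧ (∀ ε : ℝ, 0 < ε → ∀ᶠ k : ℕ in Filter.atTop, ∀ S : ℕ, R ≤ reg.a k * (2 * S + 1) → let N : ℕ := 2 * S + 1; let mq : Fin Nf → ℝ := fun f => reg.mcrit k + reg.a k * m f / reg.Zm k; let wt : GaugeConfig 4 N (Matrix.specialUnitaryGroup (Fin 3) ℂ) → ℝ := fun U => ∏ f, ‖fermionDet (wilsonDirac (fundamentalRep (Fin 3)) U (mq f) 1)‖; let P : (GaugeConfig 4 N (Matrix.specialUnitaryGroup (Fin 3) ℂ) → Prop) → ℝ := fun E => (∫ U, (if E U then (1 : ℝ) else 0) * wt U ∂(wilsonMeasure (d := 4) (L := N) (fundamentalRep (Fin 3)) (reg.β k))) / (∫ U, wt U ∂(wilsonMeasure (d := 4) (L := N) (fundamentalRep (Fin 3)) (reg.β k))); let J : ℕ := Nat.log 2 (⌊ℓ / reg.a k⌋₊ / b₀) + 1; ∃ δ : ℕ → ℝ, ∑ j ∈ Finset.range J, δ j ≤ ε ∧ ∀ j < J, ∀ s : Fin 4 → ℕ,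 (∀ i, b₀ * 2 ^ j ≤ s i ∧ s i < b₀ * 2 ^ (j + 2) ∧ s i ≤ N ∧ (s i : ℝ) * reg.a k ≤ ℓ) → P (fun U => ∃ f, IsSignDefect U (mq f) j s) ≤ δ j) ∧ PinClause Nf reg M₀ m R) →
      ∃ reg' : QCDRegularisation Nf, reg'.HasMassScaling ∧ (reg'.scheme 0 0 0).HasAsymptoticScaling ∧
      ∃ M₀' : ℝ, 0 ≤ M₀' ∧ ∃ b₀' : ℕ, 2 ≤ b₀' ∧ ∃ ℓ' : ℝ, 0 < ℓ' ∧
      (∀ m : Fin Nf → ℝ, (∀ f, M₀' < m f) → ∃ R : ℝ, 0 < R ∧ (∀ ε : ℝ, 0 < ε → ∀ᶠ k : ℕ in Filter.atTop, ∀ S : ℕ, R ≤ reg'.a k * (2 * S + 1) → let N : ℕ := 2 * S + 1; let mq : Fin Nf → ℝ := fun f => reg'.mcrit k + reg'.a k * m f / reg'.Zm k; let wt : GaugeConfig 4 N (Matrix.specialUnitaryGroup (Fin 3) ℂ) → ℝ := fun U => ∏ f, ‖fermionDet (wilsonDirac (fundamentalRep (Fin 3)) U (mq f) 1)‖; let P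 : (GaugeConfig 4 N (Matrix.specialUnitaryGroup (Fin 3) ℂ) → Prop) → ℝ := fun E => (∫ U, (if E U then (1 : ℝ) else 0) * wt U ∂(wilsonMeasure (d := 4) (L := N) (fundamentalRep (Fin 3)) (reg'.β k))) / (∫ U, wt U ∂(wilsonMeasure (d := 4) (L := N) (fundamentalRep (Fin 3)) (reg'.β k))); let J : ℕ := Nat.log 2 (⌊ℓ' / reg'.a k⌋₊ / b₀') + 1; ∃ δ : ℕ → ℝ, ∑ j ∈ Finset.range J, δ j ≤ ε ∧ ∀ j < J, ∀ s : Fin 4 → ℕ, (∀ i, b₀' * 2 ^ j ≤ s i ∧ s i < b₀' * 2 ^ (j + 2) ∧ s i ≤ N ∧ (s i : ℝ) * reg'.a k ≤ ℓ') → P (fun U => ∃ f, IsSignDefect U (mq f) j s) ≤ δ j) ∧ PinClause Nf reg' M₀' m R) ∧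
      ∃ M₁ ℓ₁ : ℝ, 0 < ℓ₁ ∧ ∀ m : Fin Nf → ℝ, (∀ f, M₁ < m f) →
        ∃ R C α t₀ : ℝ, 0 < α ∧ 0 < t₀ ∧ ∀ᶠ k : ℕ in Filter.atTop, ∀ S : ℕ, R ≤ reg'.a k * (2 * S + 1) →
          let N : ℕ := 2 * S + 1
          let mq : Fin Nf → ℝ := fun f => reg'.mcrit k + reg'.a k * m f / reg'.Zm k
          let wt : GaugeConfig 4 N (Matrix.specialUnitaryGroup (Fin 3) ℂ) → ℝ := fun U =>
            ∏ f, ‖fermionDet (wilsonDirac (fundamentalRep (Fin 3)) U (mq f) 1)‖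
          let P : (GaugeConfig 4 N (Matrix.specialUnitaryGroup (Fin 3) ℂ) → Prop) → ℝ := fun E =>
            (∫ U, (if E U then (1 : ℝ) else 0) * wt U
                ∂(wilsonMeasure (d := 4) (L := N) (fundamentalRep (Fin 3)) (reg'.β k))) /
              (∫ U, wt U ∂(wilsonMeasure (d := 4) (L := N) (fundamentalRep (Fin 3)) (reg'.β k)))
          ∀ s : Fin 4 → ℕ, (∀ i, b₀' ≤ s i ∧ s i ≤ N ∧ (s i : ℝ) * reg'.a k ≤ ℓ₁) →
            (∀ i j, s i ≤ 2 * s j) → ∀ f : Fin Nf, ∀ t : ℝ, 0 < t → t ≤ t₀ →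
              P (fun U => HasSingularSeparator U (mq f) s (t / s 0)) ≤ C * t ^ α) :
    CoerciveOfDilute := by
  intro hD Nf hNf
  obtain ⟨reg, hms, has, M₀, hM₀, b₀, hb₀, ℓ, hℓ, hm⟩ := hD Nf hNf
  obtain ⟨reg', hms', has', M₀', hM₀', b₀', hb₀', ℓ', hℓ', hbody', hlaw'⟩ :=
    hW Nf reg hNf hms has M₀ hM₀ b₀ hb₀ ℓ hℓ hm
  exact ⟨reg', coerciveSeaAt_of_body_of_law hms' has' hM₀' hb₀' hℓ' hbody' hlaw'⟩

/-! ## 2. The use: the law is needed only for boxes with sides `≥ 2^r b₀` above the kinetic margin -/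

/-- **Leaf scaling of the body of `NegativeCellsDilute`.** If `(reg, M₀, b₀, ℓ)` (`M₀ ≥ 0`,
`b₀ ≥ 2`) carries the body of `NegativeCellsDilute` and, when `r ≥ 1`,
`∀ᶠ k, −4(1 − cos(π/(2^{r+2} b₀))) < mcrit k`, then `(reg, M₀, 2^r b₀, ℓ)` carries it too
(`dilution_leafScaling` per mass tuple with `R' = max R ℓ`; the pin by `pin_mono`). [folklore] -/
theorem ncdBody_leafScaling {Nf : ℕ} (reg : QCDRegularisation Nf) {M₀ : ℝ} (hM₀ : 0 ≤ M₀)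
    {b₀ : ℕ} (hb₀ : 2 ≤ b₀) {ℓ : ℝ} (hℓ : 0 < ℓ) (r : ℕ)
    (hμ : r ≠ 0 → ∀ᶠ k : ℕ in Filter.atTop,
      -(4 * (1 - Real.cos (Real.pi / (2 ^ (r + 2) * (b₀ : ℝ))))) < reg.mcrit k)
    (hbody : ∀ m : Fin Nf → ℝ, (∀ f, M₀ < m f) → ∃ R : ℝ, 0 < R ∧ (∀ ε : ℝ, 0 < ε → ∀ᶠ k : ℕ in Filter.atTop, ∀ S : ℕ, R ≤ reg.a k * (2 * S + 1) → let N : ℕ := 2 * S + 1; let mq : Fin Nf → ℝ := fun f => reg.mcrit k + reg.a k * m f / reg.Zm k; let wt : GaugeConfig 4 N (Matrix.specialUnitaryGroup (Fin 3) ℂ) → ℝ := fun U => ∏ f, ‖fermionDet (wilsonDirac (fundamentalRep (Fin 3)) U (mq f) 1)‖; let P : (GaugeConfig 4 N (Matrix.specialUnitaryGroup (Fin 3) ℂ) → Prop) → ℝ := fun E => (∫ U, (if E U then (1 : ℝ) else 0) * wt U ∂(wilsonMeasure (d := 4) (L := N) (fundamentalRep (Fin 3)) (reg.β k))) / (∫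 U, wt U ∂(wilsonMeasure (d := 4) (L := N) (fundamentalRep (Fin 3)) (reg.β k))); let J : ℕ := Nat.log 2 (⌊ℓ / reg.a k⌋₊ / b₀) + 1; ∃ δ : ℕ → ℝ, ∑ j ∈ Finset.range J, δ j ≤ ε ∧ ∀ j < J, ∀ s : Fin 4 → ℕ, (∀ i, b₀ * 2 ^ j ≤ s i ∧ s i < b₀ * 2 ^ (j + 2) ∧ s i ≤ N ∧ (s i : ℝ) * reg.a k ≤ ℓ) → P (fun U => ∃ f, IsSignDefect U (mq f) j s) ≤ δ j) ∧ PinClause Nf reg M₀ m R) :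
    ∀ m : Fin Nf → ℝ, (∀ f, M₀ < m f) → ∃ R : ℝ, 0 < R ∧ (∀ ε : ℝ, 0 < ε → ∀ᶠ k : ℕ in Filter.atTop, ∀ S : ℕ, R ≤ reg.a k * (2 * S + 1) → let N : ℕ := 2 * S + 1; let mq : Fin Nf → ℝ := fun f => reg.mcrit k + reg.a k * m f / reg.Zm k; let wt : GaugeConfig 4 N (Matrix.specialUnitaryGroup (Fin 3) ℂ) → ℝ := fun U => ∏ f, ‖fermionDet (wilsonDirac (fundamentalRep (Fin 3)) U (mq f) 1)‖; let P : (GaugeConfig 4 N (Matrix.specialUnitaryGroup (Fin 3) ℂ) → Prop) → ℝ := fun E => (∫ U, (if E U then (1 : ℝ) else 0) * wt U ∂(wilsonMeasure (d := 4) (L := N) (fundamentalRep (Fin 3)) (reg.β k))) / (∫ U, wt U ∂(wilsonMeasure (d := 4) (L := N) (fundamentalRep (Fin 3)) (reg.β k))); let J : ℕ := Nat.log 2 (⌊ℓ / reg.a k⌋₊ / (2 ^ r * b₀)) + 1; ∃ δ : ℕ → ℝ, ∑ j ∈ Finset.range J, δ j ≤ ε ∧ ∀ j < J, ∀ s : Fin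 4 → ℕ, (∀ i, 2 ^ r * b₀ * 2 ^ j ≤ s i ∧ s i < 2 ^ r * b₀ * 2 ^ (j + 2) ∧ s i ≤ N ∧ (s i : ℝ) * reg.a k ≤ ℓ) → P (fun U => ∃ f, IsSignDefect U (mq f) j s) ≤ δ j) ∧ PinClause Nf reg M₀ m R := by
  intro m hmm
  obtain ⟨R, hR, hDil, hPin⟩ := hbody m hmm
  have hm : ∀ f, 0 ≤ m f := fun f => hM₀.trans (hmm f).le
  refine ⟨max R ℓ, hR.trans_le (le_max_left _ _), ?_, pin_mono hPin le_rfl (le_max_left _ _)⟩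
  exact dilution_leafScaling reg hb₀ r hℓ (le_max_left _ _) (le_max_right _ _) m hm hμ hDil

/-- **THE LARGE-LEAF RESIDUAL of `CoerciveOfDilute`.** Suppose that for every `N_f ∈ {2,3}`, every
admissible regularisation `reg` and all data `M₀ ≥ 0`, `b₀ ≥ 2`, `ℓ > 0` carrying the body of
`NegativeCellsDilute`, there is an `r : ℕ` such that (when `r ≥ 1`) the critical mass eventually
exceeds the kinetic floor `−4(1 − cos(π/(2^{r+2} b₀)))`, and the separator Wegner law holds along
`reg` for the roughly cubic window boxes WITH ALL SIDES `≥ 2^r b₀` only (free threshold `M₁`, window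
`ℓ₁ > 0`, per-tuple `R, C, α > 0`, level cap `t₀ > 0`). THEN `CoerciveOfDilute`. Proof:
`ncdBody_leafScaling` re-derives (ii) at leaf `2^r b₀` (and keeps (iii)), and
`coerciveOfDilute_of_rewitnessedLaw` concludes with `reg' = reg`, `b₀' = 2^r b₀`. On the physical
branch `mcrit k → 0⁻` every `r` qualifies: the law need never be proved on boxes of bounded lattice
size (in particular not on the one-site box `(2,2,2,2)` of the `b₀ = 2` exposure). [folklore] -/
theorem coerciveOfDilute_of_largeLeafWegnerLaw
    (hW : ∀ (Nf : ℕ) (reg : QCDRegularisation Nf), (Nf = 2 ∨ Nf = 3) → reg.HasMassScaling →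
      (reg.scheme 0 0 0).HasAsymptoticScaling → ∀ M₀ : ℝ, 0 ≤ M₀ → ∀ b₀ : ℕ, 2 ≤ b₀ → ∀ ℓ : ℝ, 0 < ℓ →
      (∀ m : Fin Nf → ℝ, (∀ f, M₀ < m f) → ∃ R : ℝ, 0 < R ∧ (∀ ε : ℝ, 0 < ε → ∀ᶠ k : ℕ in Filter.atTop, ∀ S : ℕ, R ≤ reg.a k * (2 * S + 1) → let N : ℕ := 2 * S + 1; let mq : Fin Nf → ℝ := fun f => reg.mcrit k + reg.a k * m f / reg.Zm k; let wt : GaugeConfig 4 N (Matrix.specialUnitaryGroup (Fin 3) ℂ) → ℝ := fun U => ∏ f, ‖fermionDet (wilsonDirac (fundamentalRep (Fin 3)) U (mq f) 1)‖; let P : (GaugeConfig 4 N (Matrix.specialUnitaryGroup (Fin 3) ℂ) → Prop) → ℝ := fun E => (∫ U, (if E U then (1 : ℝ) else 0) * wt U ∂(wilsonMeasure (d := 4) (L := N) (fundamentalRep (Fin 3)) (reg.β k))) / (∫ U, wt U ∂(wilsonMeasure (d := 4) (L := N) (fundamentalRep (Fin 3)) (reg.β k))); let J : ℕ := Nat.log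 2 (⌊ℓ / reg.a k⌋₊ / b₀) + 1; ∃ δ : ℕ → ℝ, ∑ j ∈ Finset.range J, δ j ≤ ε ∧ ∀ j < J, ∀ s : Fin 4 → ℕ, (∀ i, b₀ * 2 ^ j ≤ s i ∧ s i < b₀ * 2 ^ (j + 2) ∧ s i ≤ N ∧ (s i : ℝ) * reg.a k ≤ ℓ) → P (fun U => ∃ f, IsSignDefect U (mq f) j s) ≤ δ j) ∧ PinClause Nf reg M₀ m R) →
      ∃ r : ℕ, (r ≠ 0 → ∀ᶠ k : ℕ in Filter.atTop,
          -(4 * (1 - Real.cos (Real.pi / (2 ^ (r + 2) * (b₀ : ℝ))))) < reg.mcrit k) ∧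
      ∃ M₁ ℓ₁ : ℝ, 0 < ℓ₁ ∧ ∀ m : Fin Nf → ℝ, (∀ f, M₁ < m f) →
        ∃ R C α t₀ : ℝ, 0 < α ∧ 0 < t₀ ∧ ∀ᶠ k : ℕ in Filter.atTop, ∀ S : ℕ, R ≤ reg.a k * (2 * S + 1) →
          let N : ℕ := 2 * S + 1
          let mq : Fin Nf → ℝ := fun f => reg.mcrit k + reg.a k * m f / reg.Zm k
          let wt : GaugeConfig 4 N (Matrix.specialUnitaryGroup (Fin 3) ℂ) → ℝ := fun U =>
            ∏ f, ‖fermionDet (wilsonDirac (fundamentalRep (Fin 3)) U (mq f) 1)‖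
          let P : (GaugeConfig 4 N (Matrix.specialUnitaryGroup (Fin 3) ℂ) → Prop) → ℝ := fun E =>
            (∫ U, (if E U then (1 : ℝ) else 0) * wt U
                ∂(wilsonMeasure (d := 4) (L := N) (fundamentalRep (Fin 3)) (reg.β k))) /
              (∫ U, wt U ∂(wilsonMeasure (d := 4) (L := N) (fundamentalRep (Fin 3)) (reg.β k)))
          ∀ s : Fin 4 → ℕ, (∀ i, 2 ^ r * b₀ ≤ s i ∧ s i ≤ N ∧ (s i : ℝ) * reg.a k ≤ ℓ₁) →
            (∀ i j, s i ≤ 2 * s j) → ∀ f : Fin Nf, ∀ t : ℝ, 0 < t → t ≤ t₀ →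
              P (fun U => HasSingularSeparator U (mq f) s (t / s 0)) ≤ C * t ^ α) :
    CoerciveOfDilute := by
  refine coerciveOfDilute_of_rewitnessedLaw fun Nf reg hNf hms has M₀ hM₀ b₀ hb₀ ℓ hℓ hbody => ?_
  obtain ⟨r, hμ, hlaw⟩ := hW Nf reg hNf hms has M₀ hM₀ b₀ hb₀ ℓ hℓ hbody
  have hb₀r : 2 ≤ 2 ^ r * b₀ := le_trans hb₀ (Nat.le_mul_of_pos_left b₀ (by positivity))
  exact ⟨reg, hms, has, M₀, hM₀, 2 ^ r * b₀, hb₀r, ℓ, hℓ,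
    ncdBody_leafScaling reg hM₀ hb₀ hℓ r hμ hbody, hlaw⟩

end Summit.QuantumFields.QCD.Theorems.NestedDissectionSeaCoerciveOfDilute

end
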